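import Summits.Ventures.PercRepro.C025ProfilePLDCertificate

/-!
# THE COLOOP-TRICK TABLE FOR «M ⊕ U_{3,5} ⊕ coloop» AT RANK ≤ 12 (night-3 g36)

`proofs/NIGHT3-G36-CEILING.md` §2 (d).  A pointwise symmetrised certificate, for every canonical (PLD) instance `(lo, hi, δ)` of
`M ⊕ U_{3,5} ⊕ coloop` (`lo ≤ hi ≤ 16`, `δ ≤ 16`), as a nonnegative combination of the strong (PLD) instances of `M` on `[0, 12]²`
(HiGHS vertex + exact rational reconstruction + exact pointwise re-verification, kit j336880, lab/certtab_col.py), verified here by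
`decide`.  THE COLOOP TRICK: every (PLD) instance of `N ⊕ coloop` is the sum of three instances of `N` (g27's exact identity), and
the SUMS are certifiable where the bare instances of `M ⊕ U_{3,5}` are not — `U_{2,3}` alone is not certifiable at rank 7
(`C025ProfilePLDLineFarkasSeven`), with a coloop it is certifiable at every rank ≤ 18 (kit j336842).
No `def`, no `instance`, no notation.  Axioms: standard.
-/

open scoped Matroid

namespace PercRepro

open Finset ThmH

namespace PLDColoop

variable {α : Type} [DecidableEq α]

set_option maxRecDepth 16384 in
set_option maxHeartbeats 400000000 in
/-- THE COLOOP-TRICK TABLE (part 15.0: δ ∈ [15, 16), lo ∈ [0, 17)): a pointwise symmetrised certificate for every canonical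
target, as a finite computation. -/
theorem col_uniform_3_5_table_12_part15 :
    ∀ T : ℕ → ℕ → ℕ → ℕ × List (ℕ × ℕ × ℕ × ℕ × ℕ), T = (fun _ _ _ : ℕ => ((1 : ℕ), ([] : List (ℕ × ℕ × ℕ × ℕ × ℕ)))) →
      ∀ lo ∈ range 17, ∀ hi ∈ range 17, ∀ δ ∈ Ico 15 16, lo ≤ hi →
      0 < (T lo hi δ).1 ∧
      (∀ k ∈ (T lo hi δ).2, k.2.2.2.1 ≤ k.1 + k.2.1 + k.2.2.1 ∧ (k.1 = 0 ∨ k.1 + k.2.1 + k.2.2.1 ≤ k.2.2.2.1)) ∧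
      ∀ x ∈ range 13, ∀ f ∈ range 13,
        (T lo hi δ).1 * (∑ i ∈ range 6, Nat.choose 5 i * ((if lo ≤ x + min i 3 ∧ x + min i 3 ≤ hi ∧ (if lo = 0 then 0 else lo + hi + δ) ≤ f + (min (5 - i) 3 + 1) + (x + min i 3) then (f + (min (5 - i) 3 + 1)).choose δ else 0) + (if lo ≤ x + (min i 3 + 1) ∧ x + (min i 3 + 1) ≤ hi ∧ (if lo = 0 then 0 else lo + hi + δ) ≤ f + min (5 - i) 3 + (x + (min i 3 + 1)) then (f + min (5 - i) 3).choose δ else 0))) + (T lo hi δ).1 * (∑ i ∈ range 6, Nat.choose 5 i * ((if lo ≤ f + min i 3 ∧ f + min i 3 ≤ hi ∧ (if lo = 0 then 0 else lo + hi + δ) ≤ x + (min (5 - i) 3 + 1) + (f + min i 3) then (x + (min (5 - i) 3 + 1)).choose δ else 0) + (if lo ≤ f + (min i 3 + 1) ∧ f + (min i 3 + 1) ≤ hi ∧ (if lo = 0 then 0 else lo + hi + δ) ≤ x + min (5 - i) 3 + (f + (min i 3 + 1)) then (x + min (5 - i) 3).choose δ else 0))) +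
          (((T lo hi δ).2).map (fun k : (ℕ × ℕ × ℕ × ℕ × ℕ) => k.2.2.2.2 *
          ((if k.1 + k.2.2.1 ≤ f ∧ f ≤ k.2.1 + k.2.2.1 then f.choose k.2.2.1 else 0) +
            (if k.1 + k.2.2.1 ≤ x ∧ x ≤ k.2.1 + k.2.2.1 then x.choose k.2.2.1 else 0)))).sum ≤
        (T lo hi δ).1 * (∑ i ∈ range 6, Nat.choose 5 i * ((if lo + δ ≤ f + (min (5 - i) 3 + 1) ∧ f + (min (5 - i) 3 + 1) ≤ hi + δ then (f + (min (5 - i) 3 + 1)).choose δ else 0) + (if lo + δ ≤ f + min (5 - i) 3 ∧ f + min (5 - i) 3 ≤ hi + δ then (f + min (5 - i) 3).choose δ else 0))) + (T lo hi δ).1 * (∑ i ∈ range 6, Nat.choose 5 i * ((if lo + δ ≤ x + (min (5 - i) 3 + 1) ∧ x + (min (5 - i) 3 + 1) ≤ hi + δ then (x + (min (5 - i) 3 + 1)).choose δ else 0) + (if lo + δ ≤ x + min (5 - i) 3 ∧ x + min (5 - i) 3 ≤ hi + δ then (x + min (5 - i) 3).choose δ else 0))) +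
          (((T lo hi δ).2).map (fun k : (ℕ × ℕ × ℕ × ℕ × ℕ) => k.2.2.2.2 *
          ((if k.1 ≤ x ∧ x ≤ k.2.1 ∧ k.2.2.2.1 ≤ f + x then f.choose k.2.2.1 else 0) +
            (if k.1 ≤ f ∧ f ≤ k.2.1 ∧ k.2.2.2.1 ≤ x + f then x.choose k.2.2.1 else 0)))).sum := by
  intro T hT
  subst hT
  decide

end PLDColoop

end PercRepro
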